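import Literature.Geometry.Lorentzian.TrappedSurface
import HarnessLib

/-!
# The null-inward stability pencil of a marginally trapped surface: lower bounds `λ ≥ κ`

For a spacelike surface `f : S → M` of codimension two in a time-oriented Lorentzian manifold
`(M, g, τ)` with null normal pair `P = (L, L̲)` (`g(L, L̲) = -2`, `TrappedSurface.lean`), the
*variation* `δ_q θ_L` of the outer null expansion along a vector field `q` along `f` is the
`s`-derivative at `s = 0` of `θ_{L_s}(F_s)` for a one-parameter deformation `F : ℝ × S → M` of
`f = F_0` with initial velocity `q` and a differentiable choice of null normals `L_s` of `F_s`
(Andersson–Mars–Simon 2008, §3: "depends only on `q` and on the null vector field `l` and its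
first variation (if `S` is a MOTS this last dependence also drops out), but not on the details of
the map `Φ`"; Lemma 3.1 gives the formula, Lemma 3.2 the MOTS case `δ_{ψ v} θ = L_v ψ` with the
*stability operator* `L_v` of Def. 3.1).  Along the *null inward* direction `q = ψ · (-L̲)`,
`ψ > 0`, this is the MOTS-stability operator `L_{-k}` "in the `-k` direction" (AMS 2008, §5, after
Prop. 5.2; Jaramillo 2012, Def. 1 (ii): "outermost stable in the `-k` direction if there exists
`X = ψ(-k)`, `ψ > 0`, with `δ_X θ^{(ℓ)} ≥ 0`").  Its *principal eigenvalue* (AMS 2008, Lemma 4.1,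
Def. 5.1 and Prop. 5.1: stably outermost iff `λ ≥ 0`) admits the Donsker–Varadhan
characterisation `λ = sup_{ψ > 0} inf_S ψ⁻¹ L ψ` (AMS 2008, §4), so that a bound `λ ≥ κ` for the
*pencil* `L_{-L̲} ψ = λ · (-θ_L̲) ψ` (weight `-θ_L̲ > 0` on a marginally trapped surface) is
witnessed by one positive test function `ψ` with `δ_{ψ(-L̲)} θ_L ≥ κ · (-θ_L̲) · ψ` pointwise.  On a
section of a Killing / isolated horizon with surface gravity `κ^{(ℓ)}` this holds with equality for
the adapted pair: `δ_{ψ(-k_o)} θ^{(ℓ_o)} = -κ^{(ℓ)} θ^{(k_o)}` (Jaramillo 2012, Lemma 1, after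
Booth–Fairhurst 2007 and Mars 2012), which is why the bound is a *quasi-local surface-gravity
lower bound*.

This file defines the witness form of that bound, requested verbatim by the route
`FinalStateConjecture/SpectralSurfaceGravity` (items `HorizonSubextremal`, `LinearRedShift`,
`KerrCalibration`, `GenericRedShiftedSettling`, where the block below was inlined four times):

* `LorentzianMetric.NullInwardPencilGe hpb hf P κ m` — there are a test function `ψ : S → ℝ`
  with `m ≤ ψ ≤ 1`, a deformation `F : ℝ → S → M` of `f = F 0`, jointly `C²`, by spacelike
  immersions, with null normal pairs `Q s` of `F s` whose outer null normal `(s, y) ↦ (Q s).L y`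
  is continuous into `TM` and starts at `(Q 0).L = P.L`, with initial velocity
  `∂_s F|₀ = -ψ · L̲`, such that for every `y` the derivative
  `D(y) = d/ds θ_{(Q s).L}(F s)(y)|_{s=0}` exists and `κ · (-θ_L̲(y)) · ψ(y) ≤ D(y)`.

and proves the elementary sanity lemmas asked for: antitonicity in `κ`
(`NullInwardPencilGe.of_kappa_le`, needs `θ_L̲ ≤ 0` and `0 ≤ m`), antitonicity in `m`
(`NullInwardPencilGe.of_bound_le`), the degenerate case `m ≤ 0` (`nullInwardPencilGe_of_nonpos`,
the constant family with `ψ = 0`: this is why the route items carry `0 < m`), and the behaviour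
under the constant boost `(L, L̲) ↦ (c L, c⁻¹ L̲)`, `c > 0` (`NullNormalPair.constSmul`): the
bound `κ` becomes `c κ` (`NullInwardPencilGe.constSmul`), exactly as a surface gravity rescales
with the normalisation of the null generator.  On the way we record the (unconditional)
homogeneity of the tree's second fundamental form, mean curvature and null expansion in the normal
field (`secondFundamentalForm_const_smul`, `meanCurvature_const_smul`,
`nullExpansion_const_smul`), and that marginal trappedness is boost invariant
(`IsMarginallyTrapped.constSmul`).

## Design choices

* The predicate is stated for the *given* pair `P` of `f`: the family's outer null normal is tied
  to `P.L` at `s = 0` (`(Q 0).L y = P.L y`, a cross-fibre equation in `E`, as `F 0 = f` holds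
  only propositionally), the velocity and the weight `-θ_L̲` use `P.L̲`.  Marginal trappedness
  of `(f, P)` (`IsMarginallyTrapped hpb hf P`), positivity `0 < m` and `0 < κ` are NOT part of
  the predicate (the route states them next to it); without `θ_L = 0` the number `D` depends on
  the first variation of the null frame (the term `A θ_L` of AMS 2008, Lemma 3.1).
* Regularity is copied from the route items: `F` jointly `C²` as a map `ℝ × S → M`
  (model `𝓘(ℝ, ℝ).prod I''`), each `F s` a spacelike immersion (hence `C^{n+1}` in `y`), the lift
  `(s, y) ↦ ((F s y), (Q s).L y)` continuous (`C⁰`) into `TM`; velocities are `velocity` of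
  `Geodesic.lean` (`= mfderiv 𝓘(ℝ, ℝ) I (fun s ↦ F s y) 0 1` by `rfl`); the derivative `D` is a
  `HasDerivAt` of the real function `s ↦ θ_{(Q s).L}(F s)(y)`.
* General codimension and model `I''` of `S` (as in `TrappedSurface.lean`); the intended use is
  `S` a compact `2`-manifold (`𝓡 2`) in a `4`-dimensional spacetime.
* What is NOT here: the independence of `D` from the family on a MOTS (AMS 2008, Lemma 3.1) and
  the existence of the principal eigenfunction (AMS 2008, Lemma 4.1) are not vendored as named
  facts; the predicate is the witness ("sub-solution") form, which is all the route consumes.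

## References

* L. Andersson, M. Mars, W. Simon, *Stability of marginally outer trapped surfaces and existence
  of marginally outer trapped tubes*, Adv. Theor. Math. Phys. 12 (2008) 853–888,
  arXiv:0704.2889: §3 (variation `δ_q θ`, Lemma 3.1, Def. 3.1, Lemma 3.2), §4 (Lemma 4.1,
  Donsker–Varadhan formulas), §5 (Def. 5.1, Prop. 5.1, the direction `-k` after Prop. 5.2)
  (key `AnderssonMarsSimon2008`).
* J. L. Jaramillo, *A note on degeneracy, marginal stability and extremality of black hole
  horizons*, Class. Quantum Grav. 29 (2012) 177001, arXiv:1206.1271: Def. 1 (ii)–(iii),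
  Lemma 1 (key `Jaramillo2012`).
-/

noncomputable section

open Bundle Set Manifold Filter Function
open scoped ContDiff Topology

namespace Literature.Geometry.Lorentzian

variable {E : Type*} [NormedAddCommGroup E] [NormedSpace ℝ E] {H : Type*} [TopologicalSpace H]
  {I : ModelWithCorners ℝ E H} {M : Type*} [TopologicalSpace M] [ChartedSpace H M]
  {E'' : Type*} [NormedAddCommGroup E''] [NormedSpace ℝ E''] {H'' : Type*} [TopologicalSpace H'']
  {I'' : ModelWithCorners ℝ E'' H''} {S : Type*} [TopologicalSpace S] [ChartedSpace H'' S]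
  [IsManifold I ∞ M] {n : ℕ∞ω}

/-! ### Constant multiples of lifts and of covariant derivatives along curves -/

/-- A constant multiple of a `C^k` map `p ↦ (b p, v p)` into the tangent bundle (over an arbitrary
base map `b : N → M`) is `C^k`: in the trivialisation at `b p₀` the fibre coordinate is multiplied
by `a` (fibrewise linearity of the trivialisation; Mathlib `Bundle.contMDiffAt_totalSpace`).
[folklore] -/
theorem contMDiff_totalSpace_const_smul {EN : Type*} [NormedAddCommGroup EN] [NormedSpace ℝ EN]
    {HN : Type*} [TopologicalSpace HN] {J : ModelWithCorners ℝ EN HN} {N : Type*}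
    [TopologicalSpace N] [ChartedSpace HN N] {k : ℕ∞ω} {b : N → M}
    {v : Π p, TangentSpace I (b p)} (a : ℝ)
    (hv : ContMDiff J I.tangent k (fun p ↦ (TotalSpace.mk' E (b p) (v p) : TangentBundle I M))) :
    ContMDiff J I.tangent k (fun p ↦ (TotalSpace.mk' E (b p) (a • v p) : TangentBundle I M)) := by
  intro p₀
  have h := hv p₀
  rw [contMDiffAt_totalSpace] at h ⊢
  obtain ⟨hb, h2⟩ := h
  refine ⟨hb, ?_⟩
  set e := trivializationAt E (TangentSpace I : M → Type _) (b p₀) with he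
  have hmem : ∀ᶠ p in 𝓝 p₀, b p ∈ e.baseSet :=
    hb.continuousAt.preimage_mem_nhds
      (e.open_baseSet.mem_nhds (FiberBundle.mem_baseSet_trivializationAt' (b p₀)))
  have ha : ContMDiffAt J 𝓘(ℝ, ℝ) k (fun _ : N ↦ a) p₀ := contMDiffAt_const
  refine (ha.smul h2).congr_of_eventuallyEq (hmem.mono fun p hp ↦ ?_)
  exact (e.linear ℝ hp).map_smul a (v p)

/-- The frame formula for the covariant derivative along a curve is homogeneous under *constant*
rescaling of the field, with no differentiability hypothesis: `D(a W)/dt = a DW/dt` (the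
coefficient functions are multiplied by `a`, and `(a c)' = a c'` holds for the junk value of `deriv`
as well). O'Neill 1983, Ch. 3, Prop. 3.18 (1). [folklore] -/
theorem covariantDerivAlongFrame_const_smul [FiniteDimensional ℝ E]
    (cov : CovariantDerivative I E (TangentSpace I : M → Type _)) {ι : Type*} [Fintype ι]
    (e : Trivialization E (TotalSpace.proj : TangentBundle I M → M)) [MemTrivializationAtlas e]
    (bs : Module.Basis ι ℝ E) (γ : ℝ → M) (W : Π t : ℝ, TangentSpace I (γ t)) (t₀ a : ℝ) :
    covariantDerivAlongFrame cov e bs γ (fun t ↦ a • W t) t₀ =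
      a • covariantDerivAlongFrame cov e bs γ W t₀ := by
  simp only [covariantDerivAlongFrame, map_smul, smul_eq_mul, deriv_const_mul_field, mul_smul,
    smul_add, Finset.smul_sum]

/-- `D(a W)/dt = a DW/dt` for a constant `a` (canonical frame), unconditionally.
O'Neill 1983, Ch. 3, Prop. 3.18 (1). [folklore] -/
theorem covariantDerivAlong_const_smul [FiniteDimensional ℝ E]
    (cov : CovariantDerivative I E (TangentSpace I : M → Type _)) (γ : ℝ → M)
    (W : Π t : ℝ, TangentSpace I (γ t)) (t₀ a : ℝ) :
    covariantDerivAlong cov γ (fun t ↦ a • W t) t₀ = a • covariantDerivAlong cov γ W t₀ :=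
  covariantDerivAlongFrame_const_smul cov _ _ γ W t₀ a

omit [IsManifold I ∞ M] in
/-- Velocity of a linearly reparametrised curve at `0`: `(γ(a ·))'(0) = a γ'(0)`, for `γ`
differentiable at `0` (a cross-fibre equation in `E`). O'Neill 1983, Ch. 3, proof of Lemma 3.26
(`(γ ∘ h)' = h' γ'(h)`). [folklore] -/
theorem velocity_comp_const_mul_zero {γ : ℝ → M} (a : ℝ)
    (hγ : MDifferentiableAt 𝓘(ℝ, ℝ) I γ 0) :
    velocity I (fun t ↦ γ (a * t)) 0 = a • velocity I γ 0 := by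
  have hφ : HasMFDerivAt 𝓘(ℝ, ℝ) 𝓘(ℝ, ℝ) (fun t : ℝ ↦ a * t) 0
      (a • ContinuousLinearMap.id ℝ ℝ) :=
    hasMFDerivAt_iff_hasFDerivAt.2 ((hasFDerivAt_id (0 : ℝ)).const_mul a)
  have hγ' : HasMFDerivAt 𝓘(ℝ, ℝ) I γ ((fun t : ℝ ↦ a * t) 0) (mfderiv 𝓘(ℝ, ℝ) I γ 0) := by
    rw [show (fun t : ℝ ↦ a * t) 0 = 0 from mul_zero a]
    exact hγ.hasMFDerivAt
  have h' := (hγ'.comp 0 hφ).mfderiv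
  change mfderiv 𝓘(ℝ, ℝ) I (γ ∘ fun t ↦ a * t) 0 (1 : ℝ) = a • mfderiv 𝓘(ℝ, ℝ) I γ 0 (1 : ℝ)
  rw [h', ← map_smul]
  rfl

namespace PseudoRiemannianMetric

variable {E' : Type*} [NormedAddCommGroup E'] [NormedSpace ℝ E'] {H' : Type*} [TopologicalSpace H']
  {I' : ModelWithCorners ℝ E' H'} {N : Type*} [TopologicalSpace N] [ChartedSpace H' N]
  [FiniteDimensional ℝ E] [CompleteSpace E] [Fact (1 ≤ n)]
  (g : PseudoRiemannianMetric I n E (TangentSpace I : M → Type _)) [g.HasLeviCivita] (f : N → M)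
  (ν : NormalField I f)

omit [CompleteSpace E] [Fact (1 ≤ n)] in
/-- `D_v (a ν) = a D_v ν` for a constant `a`, unconditionally (the directional covariant
derivative of `Hypersurface.lean` is the frame formula along the chart-straight curve).
O'Neill 1983, Ch. 4, Lemma 4.1 with Ch. 3, Prop. 3.18 (1). [folklore] -/
theorem normalDerivAlong_const_smul (a : ℝ) (y : N) (v : TangentSpace I' y) :
    g.normalDerivAlong f (a • ν) y v = a • g.normalDerivAlong f ν y v :=
  covariantDerivAlong_const_smul g.leviCivita (f ∘ curveThrough I' y v)
    (fun t ↦ ν (curveThrough I' y v t)) 0 a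

variable [FiniteDimensional ℝ E']

omit [CompleteSpace E] [Fact (1 ≤ n)] in
/-- The second fundamental form is homogeneous in the normal field under constant rescaling:
`K_{a ν} = a K_ν` (no regularity needed). O'Neill 1983, Ch. 4, Lemma 4.4 ff. [folklore] -/
theorem secondFundamentalForm_const_smul (a : ℝ) (y : N) :
    g.secondFundamentalForm I' f (a • ν) y = a • g.secondFundamentalForm I' f ν y := by
  haveI : FiniteDimensional ℝ (TangentSpace I' y) := inferInstanceAs (FiniteDimensional ℝ E')
  simp only [secondFundamentalForm, ← map_smul]
  congr 1
  funext i
  rw [normalDerivAlong_const_smul, map_smul, Pi.smul_apply, ContinuousLinearMap.toLinearMap_smul,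
    LinearMap.smul_comp]

variable [IsManifold I' ∞ N]

omit [CompleteSpace E] [Fact (1 ≤ n)] in
/-- The mean curvature is homogeneous in the normal field under constant rescaling:
`tr K_{a ν} = a tr K_ν`. O'Neill 1983, Ch. 4, p. 111 ff. [folklore] -/
theorem meanCurvature_const_smul (hpb : contMDiff_pullbackBilin I M I' N n)
    (hf : g.IsSpacelikeImmersion I' f) (a : ℝ) (y : N) :
    g.meanCurvature f hpb hf (a • ν) y = a * g.meanCurvature f hpb hf ν y := by
  simp only [meanCurvature, secondFundamentalForm_const_smul, PseudoRiemannianMetric.trace,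
    LinearMap.comp_smul, map_smul, smul_eq_mul]

end PseudoRiemannianMetric

namespace LorentzianMetric

/-! ### Constant boosts of null normal pairs -/

variable {g : LorentzianMetric I n M} {τ : TimeOrientation g} {f : S → M}

/-- A positive multiple of a future-directed vector is future-directed (timecones are cones).
O'Neill 1983, Ch. 5, Lemma 5.29 ff. [folklore] -/
private lemma isFutureDirected_const_smul {x : M} {v : TangentSpace I x}
    (hv : τ.IsFutureDirected v) {c : ℝ} (hc : 0 < c) : τ.IsFutureDirected (c • v) := by
  refine ⟨⟨?_, smul_ne_zero hc.ne' hv.1.2⟩, ?_⟩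
  · have h := hv.1.1
    simp only [map_smul, _root_.smul_apply, smul_eq_mul]
    exact mul_nonpos_of_nonneg_of_nonpos hc.le (mul_nonpos_of_nonneg_of_nonpos hc.le h)
  · have h := hv.2
    simp only [map_smul, smul_eq_mul]
    exact mul_neg_of_pos_of_neg hc h

namespace NullNormalPair

/-- The *constant boost* `(L, L̲) ↦ (c L, c⁻¹ L̲)`, `c > 0`, of a null normal pair: again a null
normal pair (normality, nullity, time orientation and `g(cL, c⁻¹L̲) = -2` are preserved, and
constant multiples of `C¹` lifts are `C¹`).  In codimension two these boosts (with `c` a positive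
function) and the swap exhaust the null normal pairs. Hawking–Ellis 1973, §4.2; Andersson–Mars–
Simon 2008, §3 ("`L_w ψ = L_{Fv} ψ = L_v(Fψ)`", the boost freedom of the null basis);
Jaramillo 2012, before Lemma 1 (`ℓ → f ℓ`, `k → f⁻¹ k`). [cite: AnderssonMarsSimon2008, §3] -/
def constSmul (P : NullNormalPair I'' g τ f) (c : ℝ) (hc : 0 < c) : NullNormalPair I'' g τ f where
  L := c • P.L
  Lbar := c⁻¹ • P.Lbar
  isNormalTo_L y v := by
    simp only [Pi.smul_apply, map_smul, _root_.smul_apply, P.isNormalTo_L y v, smul_zero]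
  isNormalTo_Lbar y v := by
    simp only [Pi.smul_apply, map_smul, _root_.smul_apply, P.isNormalTo_Lbar y v, smul_zero]
  isNull_L y := ⟨by simp only [Pi.smul_apply, map_smul, _root_.smul_apply, (P.isNull_L y).1,
      smul_zero], smul_ne_zero hc.ne' (P.isNull_L y).2⟩
  isNull_Lbar y := ⟨by simp only [Pi.smul_apply, map_smul, _root_.smul_apply, (P.isNull_Lbar y).1,
      smul_zero], smul_ne_zero (inv_pos.2 hc).ne' (P.isNull_Lbar y).2⟩
  isFutureDirected_L y := isFutureDirected_const_smul (P.isFutureDirected_L y) hc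
  isFutureDirected_Lbar y := isFutureDirected_const_smul (P.isFutureDirected_Lbar y) (inv_pos.2 hc)
  val_L_Lbar y := by
    simp only [Pi.smul_apply, map_smul, _root_.smul_apply, P.val_L_Lbar y, smul_eq_mul]
    rw [← mul_assoc, inv_mul_cancel₀ hc.ne', one_mul]
  contMDiff_L := contMDiff_totalSpace_const_smul c P.contMDiff_L
  contMDiff_Lbar := contMDiff_totalSpace_const_smul c⁻¹ P.contMDiff_Lbar

/-- The outer null normal of the boosted pair is `c L`. [folklore] -/
@[simp]
lemma constSmul_L (P : NullNormalPair I'' g τ f) (c : ℝ) (hc : 0 < c) :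
    (P.constSmul c hc).L = c • P.L := rfl

/-- The inner null normal of the boosted pair is `c⁻¹ L̲`. [folklore] -/
@[simp]
lemma constSmul_Lbar (P : NullNormalPair I'' g τ f) (c : ℝ) (hc : 0 < c) :
    (P.constSmul c hc).Lbar = c⁻¹ • P.Lbar := rfl

end NullNormalPair

/-! ### The null-inward pencil bound -/

section Pencil

variable [FiniteDimensional ℝ E] [CompleteSpace E] [Fact (1 ≤ n)] [FiniteDimensional ℝ E'']
  [IsManifold I'' ∞ S] [g.HasLeviCivita]

omit [CompleteSpace E] [Fact (1 ≤ n)] in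
/-- The null expansion is homogeneous in the null normal under constant rescaling:
`θ_{a L} = a θ_L` (unconditionally, for the tree's `nullExpansion`). Andersson–Mars–Simon 2008,
§3 (boost freedom `l → F l`); Hawking–Ellis 1973, §4.2. [folklore] -/
theorem nullExpansion_const_smul (hpb : PseudoRiemannianMetric.contMDiff_pullbackBilin I M I'' S n)
    (hf : g.IsSpacelikeImmersion I'' f) (L : NormalField I f) (a : ℝ) (y : S) :
    g.nullExpansion f hpb hf (a • L) y = a * g.nullExpansion f hpb hf L y :=
  g.meanCurvature_const_smul f L hpb hf a y

omit [CompleteSpace E] [Fact (1 ≤ n)] in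
/-- Marginal trappedness (`θ_L = 0`, `θ_L̲ < 0`) is invariant under constant boosts
`(L, L̲) ↦ (c L, c⁻¹ L̲)`, `c > 0`. Andersson–Mars–Simon 2008, §3. [folklore] -/
theorem IsMarginallyTrapped.constSmul
    {hpb : PseudoRiemannianMetric.contMDiff_pullbackBilin I M I'' S n}
    {hf : g.IsSpacelikeImmersion I'' f} {P : NullNormalPair I'' g τ f}
    (h : g.IsMarginallyTrapped hpb hf P) {c : ℝ} (hc : 0 < c) :
    g.IsMarginallyTrapped hpb hf (P.constSmul c hc) := fun y ↦ by
  rw [NullNormalPair.constSmul_L, NullNormalPair.constSmul_Lbar, nullExpansion_const_smul,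
    nullExpansion_const_smul, (h y).1, mul_zero]
  exact ⟨rfl, mul_neg_of_pos_of_neg (inv_pos.2 hc) (h y).2⟩

variable (g) in
/-- **Quasi-local surface-gravity lower bound `λ₁ ≥ κ` for the null-inward stability pencil**
(witness form).  For a spacelike immersion `f : S → M` with null normal pair `P = (L, L̲)` (meant:
`f` compact and marginally trapped w.r.t. `P`, `θ_L = 0`, `θ_L̲ < 0`, stated separately as
`IsMarginallyTrapped hpb hf P`) and reals `κ`, `m`:  there are a test function `ψ : S → ℝ` with
`m ≤ ψ ≤ 1` and a one-parameter deformation `F : ℝ → S → M` of `f = F 0`, jointly `C²` on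
`ℝ × S`, through spacelike immersions `F s` carrying null normal pairs `Q s` whose outer null
normal `(s, y) ↦ (Q s).L y` is continuous into `TM` and equals `P.L` at `s = 0`, with initial
velocity `∂_s F(s, y)|₀ = -ψ(y) L̲(y)` (the null inward direction `-L̲`, speed `ψ`), such that for
every `y` the derivative `D(y) = d/ds θ_{(Q s).L}(F s)(y)|_{s = 0}` — the variation
`δ_{ψ(-L̲)} θ_L (y)` of Andersson–Mars–Simon 2008, §3 — exists and
`κ · (-θ_L̲(y)) · ψ(y) ≤ D(y)`.  Reading: `ψ` is a positive sub-solution of the generalised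
eigenvalue problem ("pencil") `δ_{ψ(-L̲)} θ_L = λ (-θ_L̲) ψ` with eigenvalue parameter `κ`, so by
the Donsker–Varadhan characterisation `λ₁ = sup_{ψ>0} inf_S ψ⁻¹ L ψ` of the principal eigenvalue
(AMS 2008, §4, Lemma 4.1; Def. 5.1, Prop. 5.1: stably outermost in the direction `-k` iff
`λ₁ ≥ 0`) the principal eigenvalue of the null-inward pencil is at least `κ`; on a section of an
isolated horizon with surface gravity `κ^{(ℓ)}` equality holds for the adapted pair,
`δ_{ψ(-k_o)} θ^{(ℓ_o)} = -κ^{(ℓ)} θ^{(k_o)}` (Jaramillo 2012, Def. 1 (ii)–(iii) and Lemma 1).  The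
shape (binders, regularity `C²`/`C⁰`, `velocity = mfderiv … 0 1`, `HasDerivAt`) is verbatim the
block inlined in the items of route `FinalStateConjecture/SpectralSurfaceGravity`.
[cite: AnderssonMarsSimon2008, §3 Lemma 3.1–3.2, §5 Def. 5.1 and Prop. 5.1] -/
def NullInwardPencilGe (hpb : PseudoRiemannianMetric.contMDiff_pullbackBilin I M I'' S n)
    (hf : g.IsSpacelikeImmersion I'' f) (P : NullNormalPair I'' g τ f) (κ m : ℝ) : Prop :=
  ∃ (ψ : S → ℝ) (F : ℝ → S → M) (Q : ∀ s, NullNormalPair I'' g τ (F s))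
    (hF : ∀ s, g.IsSpacelikeImmersion I'' (F s)),
    F 0 = f ∧
    ContMDiff (𝓘(ℝ, ℝ).prod I'') I 2 (uncurry F) ∧
    ContMDiff (𝓘(ℝ, ℝ).prod I'') I.tangent 0
      (fun p : ℝ × S ↦ (TotalSpace.mk' E (F p.1 p.2) ((Q p.1).L p.2) : TangentBundle I M)) ∧
    (∀ y, (Q 0).L y = P.L y) ∧
    (∀ y, m ≤ ψ y ∧ ψ y ≤ 1) ∧
    (∀ y, velocity I (fun s ↦ F s y) 0 = (-(ψ y)) • P.Lbar y) ∧
    ∀ y, ∃ D : ℝ,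
      HasDerivAt (fun s ↦ g.nullExpansion (F s) hpb (hF s) (Q s).L y) D 0 ∧
        κ * (-(g.nullExpansion f hpb hf P.Lbar y)) * ψ y ≤ D

variable {hpb : PseudoRiemannianMetric.contMDiff_pullbackBilin I M I'' S n}
  {hf : g.IsSpacelikeImmersion I'' f} {P : NullNormalPair I'' g τ f} {κ κ' m m' : ℝ}

omit [CompleteSpace E] [Fact (1 ≤ n)] in
/-- Unfolding lemma for `NullInwardPencilGe`. [folklore] -/
lemma nullInwardPencilGe_iff :
    g.NullInwardPencilGe hpb hf P κ m ↔
      ∃ (ψ : S → ℝ) (F : ℝ → S → M) (Q : ∀ s, NullNormalPair I'' g τ (F s))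
        (hF : ∀ s, g.IsSpacelikeImmersion I'' (F s)),
        F 0 = f ∧
        ContMDiff (𝓘(ℝ, ℝ).prod I'') I 2 (uncurry F) ∧
        ContMDiff (𝓘(ℝ, ℝ).prod I'') I.tangent 0
          (fun p : ℝ × S ↦ (TotalSpace.mk' E (F p.1 p.2) ((Q p.1).L p.2) : TangentBundle I M)) ∧
        (∀ y, (Q 0).L y = P.L y) ∧
        (∀ y, m ≤ ψ y ∧ ψ y ≤ 1) ∧
        (∀ y, mfderiv 𝓘(ℝ, ℝ) I (fun s ↦ F s y) 0 1 = (-(ψ y)) • P.Lbar y) ∧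
        ∀ y, ∃ D : ℝ,
          HasDerivAt (fun s ↦ g.nullExpansion (F s) hpb (hF s) (Q s).L y) D 0 ∧
            κ * (-(g.nullExpansion f hpb hf P.Lbar y)) * ψ y ≤ D :=
  Iff.rfl

omit [CompleteSpace E] [Fact (1 ≤ n)] in
/-- **Antitone in `κ`.** If `θ_L̲ ≤ 0` (e.g. `f` marginally trapped w.r.t. `P`) and `0 ≤ m`, a
pencil bound `κ` implies every smaller bound `κ' ≤ κ` (same witnesses: the weight `(-θ_L̲) ψ` is
nonnegative). [folklore] -/
theorem NullInwardPencilGe.of_kappa_le (h : g.NullInwardPencilGe hpb hf P κ m)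
    (hθ : ∀ y, g.nullExpansion f hpb hf P.Lbar y ≤ 0) (hm : 0 ≤ m) (hκ : κ' ≤ κ) :
    g.NullInwardPencilGe hpb hf P κ' m := by
  obtain ⟨ψ, F, Q, hF, hF0, hF2, hQc, hQ0, hψ, hvel, hD⟩ := h
  refine ⟨ψ, F, Q, hF, hF0, hF2, hQc, hQ0, hψ, hvel, fun y ↦ ?_⟩
  obtain ⟨D, hDd, hDb⟩ := hD y
  refine ⟨D, hDd, le_trans ?_ hDb⟩
  have hw : 0 ≤ -(g.nullExpansion f hpb hf P.Lbar y) * ψ y :=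
    mul_nonneg (neg_nonneg.2 (hθ y)) (hm.trans (hψ y).1)
  calc κ' * -(g.nullExpansion f hpb hf P.Lbar y) * ψ y
      = κ' * (-(g.nullExpansion f hpb hf P.Lbar y) * ψ y) := mul_assoc _ _ _
    _ ≤ κ * (-(g.nullExpansion f hpb hf P.Lbar y) * ψ y) := mul_le_mul_of_nonneg_right hκ hw
    _ = κ * -(g.nullExpansion f hpb hf P.Lbar y) * ψ y := (mul_assoc _ _ _).symm

omit [CompleteSpace E] [Fact (1 ≤ n)] in
/-- **Antitone in `κ`, marginally trapped form.** [folklore] -/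
theorem NullInwardPencilGe.of_kappa_le_of_isMarginallyTrapped
    (h : g.NullInwardPencilGe hpb hf P κ m) (hP : g.IsMarginallyTrapped hpb hf P) (hm : 0 ≤ m)
    (hκ : κ' ≤ κ) : g.NullInwardPencilGe hpb hf P κ' m :=
  h.of_kappa_le (fun y ↦ (hP y).2.le) hm hκ

omit [CompleteSpace E] [Fact (1 ≤ n)] in
/-- **Antitone in the lower bound `m` of the witness.** [folklore] -/
theorem NullInwardPencilGe.of_bound_le (h : g.NullInwardPencilGe hpb hf P κ m) (hm : m' ≤ m) :
    g.NullInwardPencilGe hpb hf P κ m' := by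
  obtain ⟨ψ, F, Q, hF, hF0, hF2, hQc, hQ0, hψ, hvel, hD⟩ := h
  exact ⟨ψ, F, Q, hF, hF0, hF2, hQc, hQ0, fun y ↦ ⟨hm.trans (hψ y).1, (hψ y).2⟩, hvel, hD⟩

omit [CompleteSpace E] in
/-- **Degenerate case `m ≤ 0`.** Without a positive lower bound on the witness the predicate holds
for every `κ`: take `ψ = 0` and the constant family `F s = f`, `Q s = P` (velocity `0 = -0 · L̲`,
`D = 0`, and `κ · (-θ_L̲) · 0 ≤ 0`).  This is why the route items require `0 < m`. [folklore] -/
theorem nullInwardPencilGe_of_nonpos (hpb : PseudoRiemannianMetric.contMDiff_pullbackBilin I M I'' S n)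
    (hf : g.IsSpacelikeImmersion I'' f) (P : NullNormalPair I'' g τ f) (κ : ℝ) (hm : m ≤ 0) :
    g.NullInwardPencilGe hpb hf P κ m := by
  have hn : (2 : ℕ∞ω) ≤ n + 1 := by
    have h1 : (1 : ℕ∞ω) ≤ n := Fact.out
    calc (2 : ℕ∞ω) = 1 + 1 := by norm_num
      _ ≤ n + 1 := add_le_add h1 le_rfl
  refine ⟨fun _ ↦ 0, fun _ ↦ f, fun _ ↦ P, fun _ ↦ hf, rfl, ?_, ?_, fun _ ↦ rfl,
    fun _ ↦ ⟨hm, zero_le_one⟩, fun y ↦ ?_, fun y ↦ ⟨0, hasDerivAt_const _ _, by simp⟩⟩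
  · exact (hf.contMDiff.of_le hn).comp contMDiff_snd
  · exact (P.contMDiff_L.of_le (by simp)).comp contMDiff_snd
  · rw [neg_zero, zero_smul]
    change mfderiv 𝓘(ℝ, ℝ) I (fun _ : ℝ ↦ f y) 0 (1 : ℝ) = 0
    rw [mfderiv_const]
    rfl

omit [CompleteSpace E] [Fact (1 ≤ n)] in
/-- **Constant boosts rescale the bound: `κ ↦ c κ`.**  If `(f, P)` satisfies the pencil bound `κ`
with witness bound `m`, then the boosted pair `(c L, c⁻¹ L̲)`, `c > 0`, satisfies the bound `c κ`
with the same `m`: reparametrise the family by `s ↦ c⁻¹ s` (velocity `-ψ · c⁻¹ L̲`), boost the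
pairs `Q s` by `c` (so `θ_{c L_s} = c θ_{L_s}` and `D` is unchanged), and note
`c κ · (-c⁻¹ θ_L̲) ψ = κ (-θ_L̲) ψ`.  This is the scaling of a surface gravity with the
normalisation of the null generator (Jaramillo 2012, before Lemma 1: `ℓ → f ℓ`, `k → f⁻¹ k`,
`ψ → f ψ`; here `f = c` constant and `ψ` is kept by reparametrising). [folklore] -/
theorem NullInwardPencilGe.constSmul (h : g.NullInwardPencilGe hpb hf P κ m) {c : ℝ}
    (hc : 0 < c) : g.NullInwardPencilGe hpb hf (P.constSmul c hc) (c * κ) m := by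
  obtain ⟨ψ, F, Q, hF, hF0, hF2, hQc, hQ0, hψ, hvel, hD⟩ := h
  -- the reparametrisation `(s, y) ↦ (c⁻¹ s, y)` is smooth
  have hrep : ContMDiff (𝓘(ℝ, ℝ).prod I'') (𝓘(ℝ, ℝ).prod I'') 2
      (fun p : ℝ × S ↦ (c⁻¹ * p.1, p.2)) :=
    (((contDiff_const (c := c⁻¹)).mul contDiff_id).contMDiff.comp contMDiff_fst).prodMk
      contMDiff_snd
  refine ⟨ψ, fun s ↦ F (c⁻¹ * s), fun s ↦ (Q (c⁻¹ * s)).constSmul c hc,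
    fun s ↦ hF (c⁻¹ * s), ?_, hF2.comp hrep, ?_, fun y ↦ ?_, hψ, fun y ↦ ?_, fun y ↦ ?_⟩
  · -- `F (c⁻¹ 0) = f`
    change F (c⁻¹ * 0) = f
    rw [mul_zero, hF0]
  · -- continuity of the boosted outer null normal along the reparametrised family
    exact (contMDiff_totalSpace_const_smul c hQc).comp (hrep.of_le (by simp))
  · -- at `s = 0` the outer null normal is `c L`
    have key : ∀ {s t : ℝ}, s = t → ((Q s).L y : E) = (Q t).L y := by
      rintro s _ rfl; rfl
    change c • (Q (c⁻¹ * 0)).L y = c • P.L y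
    rw [key (mul_zero _), hQ0 y]
    rfl
  · -- velocity `-ψ · c⁻¹ L̲`
    have hG : MDifferentiableAt 𝓘(ℝ, ℝ) I (fun s ↦ F s y) 0 :=
      ((hF2.comp (contMDiff_id.prodMk contMDiff_const)).mdifferentiableAt (by norm_num))
    have := velocity_comp_const_mul_zero (I := I) (γ := fun s ↦ F s y) c⁻¹ hG
    change velocity I (fun t ↦ F (c⁻¹ * t) y) 0 = (-(ψ y)) • (c⁻¹ • P.Lbar y)
    rw [this, hvel y, smul_comm]
    rfl
  · -- the derivative is unchanged, the weight rescales by `c⁻¹`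
    obtain ⟨D, hDd, hDb⟩ := hD y
    refine ⟨D, ?_, ?_⟩
    · have hlin : HasDerivAt (fun s : ℝ ↦ c⁻¹ * s) c⁻¹ 0 := by
        simpa using (hasDerivAt_id (0 : ℝ)).const_mul c⁻¹
      have hcomp := (hDd.comp_of_eq 0 hlin (mul_zero _).symm).const_mul c
      have hfun : (fun s ↦ g.nullExpansion (F (c⁻¹ * s)) hpb (hF (c⁻¹ * s))
          ((Q (c⁻¹ * s)).constSmul c hc).L y) =
          fun s ↦ c * ((fun s ↦ g.nullExpansion (F s) hpb (hF s) (Q s).L y) ∘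
            fun s : ℝ ↦ c⁻¹ * s) s := by
        funext s
        exact nullExpansion_const_smul hpb (hF (c⁻¹ * s)) (Q (c⁻¹ * s)).L c y
      rw [hfun]
      refine hcomp.congr_deriv ?_
      rw [← mul_assoc, mul_comm c D, mul_assoc, mul_inv_cancel₀ hc.ne', mul_one]
    · rw [NullNormalPair.constSmul_Lbar, nullExpansion_const_smul]
      calc c * κ * -(c⁻¹ * g.nullExpansion f hpb hf P.Lbar y) * ψ y
          = (c * c⁻¹) * (κ * -(g.nullExpansion f hpb hf P.Lbar y) * ψ y) := by ring
        _ = κ * -(g.nullExpansion f hpb hf P.Lbar y) * ψ y := by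
          rw [mul_inv_cancel₀ hc.ne', one_mul]
        _ ≤ D := hDb

end Pencil

end LorentzianMetric

end Literature.Geometry.Lorentzian

end
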